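import Literature.Analysis.FluidPDE.NSFourierPlancherel
import Literature.Analysis.FunctionSpaces.FourierSobolevNorm
import Mathlib.MeasureTheory.Integral.Prod
import HarnessLib

/-!
# The `L²` engine of velocity averaging: Fubini, Cauchy–Schwarz and Plancherel on slices

Topic: MathematicalPhysics / KineticTheory. Second proof file of the `L²` velocity averaging
lemma `Literature.MathematicalPhysics.KineticTheory.velocityAveraging_L2` (Cercignani–Illner–
Pulvirenti 1994, Lemma 5.3.8; Golse–Lions–Perthame–Sentis 1988). It isolates the harmonic
analysis of the proof (CIP 1994, p. 153: Fourier transform in `(t, x)`, Cauchy–Schwarz in the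
velocity variable, Plancherel) from the kinetic input, in the following abstract form.

Let `V` be a Euclidean space (space-time), `(X, ν)` an s-finite measure space (velocities),
`U, G : V × X → ℂ` with `U ∈ L¹`, `G ∈ L¹ ∩ L²` for the product measure, `U(·, x) = 0` for
`x ∉ S`, and suppose the Fourier transforms of the slices satisfy, for every frequency `q` and
`ν`-a.e. `x`, `𝓕(G(·,x))(q) = m(q,x) · 𝓕(U(·,x))(q)` with `m(q,x) ≠ 0` (for the transport
operator, `G = U + TU` and `m = 1 + 2πi(τ + ⟪ξ,k⟫)`). Then the velocity average
`ρ = ∫ U(·,x) dν(x)` satisfies `𝓕ρ(q) = ∫ 𝓕(U(·,x))(q) dν = ∫_S m⁻¹ 𝓕(G(·,x))(q) dν`, hence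

  `w(q) |𝓕ρ(q)|² ≤ (w(q) ∫_S |m(q,·)|⁻² dν) · ∫ |𝓕(G(·,x))(q)|² dν ≤ C ∫ |𝓕(G(·,x))(q)|² dν`

and, integrating in `q` (Tonelli, Plancherel slice by slice),
`∫ w |𝓕ρ|² ≤ C ‖G‖²_{L²(V × X)}` (`lintegral_mul_enorm_fourier_integral_sq_le`). Also:
`ρ ∈ L¹ ∩ L²` (`lintegral_enorm_integral_sq_le`), and the tree's Fourier-side Sobolev norm of
`ρ` is computed by the Fourier *integral* (`eFourierSobolevNorm_toLp_eq`, via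
`Literature.Analysis.FluidPDE.FourierNS.fourier_toLp_ae_eq`). Integrability of `ρ` for `U ∈ L¹` is
Mathlib's `MeasureTheory.Integrable.integral_prod_left` (not restated here).

## References

* C. Cercignani, R. Illner, M. Pulvirenti, *The Mathematical Theory of Dilute Gases* (1994),
  §5.3, Lemma 5.3.8 and its proof, p. 153.
* F. Golse, P.-L. Lions, B. Perthame, R. Sentis, J. Funct. Anal. 76 (1988) 110–125.
-/

noncomputable section

open MeasureTheory Real Set Filter Topology Function Complex FourierTransform
open scoped FourierTransform InnerProductSpace ENNReal

namespace Literature.MathematicalPhysics.KineticTheory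

/-! ### `L²` bookkeeping -/

section Helpers

variable {α : Type*} [MeasurableSpace α] {μ : Measure α} {F : Type*} [NormedAddCommGroup F]

/-- `(a^{1/2} b^{1/2})² = a b` in `ℝ≥0∞` (squaring a Cauchy–Schwarz bound). [folklore] -/
theorem mul_rpow_half_sq (a b : ℝ≥0∞) : (a ^ (1 / 2 : ℝ) * b ^ (1 / 2 : ℝ)) ^ 2 = a * b := by
  have h : ∀ c : ℝ≥0∞, (c ^ (1 / 2 : ℝ)) ^ 2 = c := fun c => by
    rw [← ENNReal.rpow_natCast, ← ENNReal.rpow_mul]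
    norm_num
  rw [mul_pow, h, h]

/-- `‖f‖_{L²} = (∫ ‖f‖ₑ²)^{1/2}`. [folklore] -/
theorem eLpNorm_two_eq_rpow (f : α → F) :
    eLpNorm f 2 μ = (∫⁻ x, ‖f x‖ₑ ^ 2 ∂μ) ^ (1 / 2 : ℝ) := by
  rw [eLpNorm_eq_lintegral_rpow_enorm_toReal two_ne_zero ENNReal.ofNat_ne_top]
  simp only [ENNReal.toReal_ofNat, ENNReal.rpow_ofNat, one_div]

/-- `∫ ‖f‖ₑ² = ‖f‖_{L²}²` (the tree's `ENNReal.rpow_half_sq`, `TorusFourierCalculus`, is not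
imported here). [folklore] -/
theorem lintegral_enorm_sq_eq (f : α → F) : ∫⁻ x, ‖f x‖ₑ ^ 2 ∂μ = eLpNorm f 2 μ ^ 2 := by
  rw [eLpNorm_two_eq_rpow, ← ENNReal.rpow_natCast, ← ENNReal.rpow_mul]
  norm_num

/-- For `f ∈ L²`, `∫ ‖f‖ₑ² < ∞`. [folklore] -/
theorem lintegral_enorm_sq_lt_top {f : α → F} (hf : MemLp f 2 μ) : ∫⁻ x, ‖f x‖ₑ ^ 2 ∂μ < ∞ := by
  rw [lintegral_enorm_sq_eq]
  exact ENNReal.pow_lt_top hf.eLpNorm_lt_top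

/-- `f ∈ L²` from `∫ ‖f‖ₑ² < ∞`. [folklore] -/
theorem memLp_two_of_lintegral_enorm_sq_lt_top {f : α → F} (hf : AEStronglyMeasurable f μ)
    (h : ∫⁻ x, ‖f x‖ₑ ^ 2 ∂μ < ∞) : MemLp f 2 μ :=
  ⟨hf, by rw [eLpNorm_two_eq_rpow]; exact ENNReal.rpow_lt_top_of_nonneg (by norm_num) h.ne⟩

end Helpers

section Engine

variable {V : Type*} [NormedAddCommGroup V] [InnerProductSpace ℝ V] [FiniteDimensional ℝ V]
  [MeasurableSpace V] [BorelSpace V]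
variable {X : Type*} [MeasurableSpace X] {ν : Measure X} [SFinite ν]

/-! ### The Fourier character as a bounded measurable multiplier -/

omit [FiniteDimensional ℝ V] in
/-- Measurability of `v ↦ e^{-2πi⟪v,q⟫}`. [folklore] -/
theorem measurable_fourierChar_inner (q : V) :
    Measurable fun v : V => ((𝐞 (-⟪v, q⟫_ℝ) : Circle) : ℂ) :=
  (continuous_subtype_val.comp
    (Real.continuous_fourierChar.comp (continuous_id.inner continuous_const).neg)).measurable

omit [SFinite ν] in
/-- Multiplying an integrable function on `V × X` by the character `e^{-2πi⟪v,q⟫}` keeps it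
integrable. [folklore] -/
theorem integrable_fourierChar_mul (q : V) {F : V × X → ℂ} (hF : Integrable F (volume.prod ν)) :
    Integrable (fun z : V × X => ((𝐞 (-⟪z.1, q⟫_ℝ) : Circle) : ℂ) * F z) (volume.prod ν) := by
  refine hF.norm.mono' (((measurable_fourierChar_inner q).comp measurable_fst).aestronglyMeasurable.mul hF.1)
    (ae_of_all _ fun z => ?_)
  rw [norm_mul, Circle.norm_coe, one_mul]

/-! ### Fourier transform of a velocity average -/

/-- **Fubini for the Fourier transform of an average**: for `U ∈ L¹(V × X)`,
`𝓕(∫ U(·,x) dν)(q) = ∫ 𝓕(U(·,x))(q) dν(x)` (CIP 1994, proof of Lemma 5.3.8: "let `û` be the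
Fourier transform of `u` with respect to `t` and `x`"). [folklore] -/
theorem fourier_integral_slice_eq {U : V × X → ℂ} (hU1 : Integrable U (volume.prod ν)) (q : V) :
    𝓕 (fun v => ∫ x, U (v, x) ∂ν) q = ∫ x, 𝓕 (fun v => U (v, x)) q ∂ν := by
  simp only [Real.fourier_eq, Circle.smul_def, smul_eq_mul]
  have h1 : ∀ v : V, ((𝐞 (-⟪v, q⟫_ℝ) : Circle) : ℂ) * ∫ x, U (v, x) ∂ν =
      ∫ x, ((𝐞 (-⟪v, q⟫_ℝ) : Circle) : ℂ) * U (v, x) ∂ν :=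
    fun v => (integral_const_mul _ _).symm
  simp_rw [h1]
  exact integral_integral_swap (integrable_fourierChar_mul q hU1)

/-- **`L²` bound of a velocity average** (Cauchy–Schwarz in the velocity variable): if
`U ∈ L²(V × X)` vanishes for `x ∉ S`, then `∫ ‖∫ U(v,x) dν‖² dv ≤ ν(S) ‖U‖²_{L²}`. [folklore] -/
theorem lintegral_enorm_integral_sq_le {U : V × X → ℂ} (hU2 : MemLp U 2 (volume.prod ν))
    {S : Set X} (hS : MeasurableSet S) (hUS : ∀ v x, x ∉ S → U (v, x) = 0) :
    ∫⁻ v, ‖∫ x, U (v, x) ∂ν‖ₑ ^ 2 ≤ ν S * ∫⁻ z, ‖U z‖ₑ ^ 2 ∂(volume.prod ν) := by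
  have hmeas : AEMeasurable (fun z => ‖U z‖ₑ ^ 2) (volume.prod ν) := hU2.1.enorm.pow_const 2
  have hsl : ∀ᵐ v ∂(volume : Measure V), AEStronglyMeasurable (fun x => U (v, x)) ν :=
    hU2.1.prodMk_left
  have hpt : ∀ᵐ v ∂(volume : Measure V),
      ‖∫ x, U (v, x) ∂ν‖ₑ ^ 2 ≤ ν S * ∫⁻ x, ‖U (v, x)‖ₑ ^ 2 ∂ν := by
    filter_upwards [hsl] with v hv
    have hf : AEMeasurable (S.indicator (1 : X → ℝ≥0∞)) ν :=
      (measurable_one.indicator hS).aemeasurable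
    have hg : AEMeasurable (fun x => ‖U (v, x)‖ₑ) ν := hv.enorm
    have hind : ∀ x, ‖U (v, x)‖ₑ = S.indicator (1 : X → ℝ≥0∞) x * ‖U (v, x)‖ₑ := by
      intro x
      by_cases hx : x ∈ S
      · rw [indicator_of_mem hx, Pi.one_apply, one_mul]
      · rw [hUS v x hx, indicator_of_notMem hx, zero_mul, enorm_zero]
    calc ‖∫ x, U (v, x) ∂ν‖ₑ ^ 2 ≤ (∫⁻ x, ‖U (v, x)‖ₑ ∂ν) ^ 2 := by
          gcongr
          exact enorm_integral_le_lintegral_enorm _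
      _ = (∫⁻ x, (S.indicator (1 : X → ℝ≥0∞) * fun x => ‖U (v, x)‖ₑ) x ∂ν) ^ 2 := by
          congr 1
          exact lintegral_congr fun x => hind x
      _ ≤ ((∫⁻ x, S.indicator (1 : X → ℝ≥0∞) x ^ (2 : ℝ) ∂ν) ^ (1 / (2 : ℝ)) *
            (∫⁻ x, ‖U (v, x)‖ₑ ^ (2 : ℝ) ∂ν) ^ (1 / (2 : ℝ))) ^ 2 := by
          gcongr
          exact ENNReal.lintegral_mul_le_Lp_mul_Lq ν Real.HolderConjugate.two_two hf hg
      _ = ν S * ∫⁻ x, ‖U (v, x)‖ₑ ^ 2 ∂ν := by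
          rw [mul_rpow_half_sq]
          simp only [ENNReal.rpow_ofNat]
          congr 1
          rw [← lintegral_indicator_one hS]
          refine lintegral_congr fun x => ?_
          by_cases hx : x ∈ S <;> simp [hx]
  calc ∫⁻ v, ‖∫ x, U (v, x) ∂ν‖ₑ ^ 2
      ≤ ∫⁻ v, ν S * ∫⁻ x, ‖U (v, x)‖ₑ ^ 2 ∂ν := lintegral_mono_ae hpt
    _ = ν S * ∫⁻ v, ∫⁻ x, ‖U (v, x)‖ₑ ^ 2 ∂ν :=
        lintegral_const_mul'' _ hmeas.lintegral_prod_right'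
    _ = ν S * ∫⁻ z, ‖U z‖ₑ ^ 2 ∂(volume.prod ν) := by rw [lintegral_prod _ hmeas]

/-- The velocity average of `U ∈ L¹ ∩ L²(V × X)` supported in `V × S`, `ν(S) < ∞`, lies in
`L²(V)` (its integrability is Mathlib's `MeasureTheory.Integrable.integral_prod_left`).
[folklore] -/
theorem memLp_two_integral_slice {U : V × X → ℂ} (hU1 : Integrable U (volume.prod ν))
    (hU2 : MemLp U 2 (volume.prod ν)) {S : Set X} (hS : MeasurableSet S) (hνS : ν S ≠ ∞)
    (hUS : ∀ v x, x ∉ S → U (v, x) = 0) :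
    MemLp (fun v => ∫ x, U (v, x) ∂ν) 2 volume := by
  refine memLp_two_of_lintegral_enorm_sq_lt_top hU1.integral_prod_left.1 ?_
  refine (lintegral_enorm_integral_sq_le hU2 hS hUS).trans_lt ?_
  exact ENNReal.mul_lt_top hνS.lt_top (lintegral_enorm_sq_lt_top hU2)

/-! ### Joint measurability of the slice transforms -/

/-- The slice Fourier transforms `(q, x) ↦ 𝓕(G(·,x))(q)` of an a.e. strongly measurable
`G` on `V × X` form an a.e. strongly measurable function on `V × X` (pass to a strongly
measurable representative, whose slice transforms are strongly measurable by Fubini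
measurability, and which changes the slice transforms only for a `ν`-null set of `x`). [folklore] -/
theorem aestronglyMeasurable_fourier_slice {G : V × X → ℂ}
    (hG : AEStronglyMeasurable G (volume.prod ν)) :
    AEStronglyMeasurable (uncurry fun (q : V) (x : X) => 𝓕 (fun v => G (v, x)) q)
      (volume.prod ν) := by
  set G' := hG.mk G with hG'
  have hG'm : StronglyMeasurable G' := hG.stronglyMeasurable_mk
  have hGG' : G =ᵐ[volume.prod ν] G' := hG.ae_eq_mk
  have hker : StronglyMeasurable
      (uncurry fun (p : V × X) (v : V) => ((𝐞 (-⟪v, p.1⟫_ℝ) : Circle) : ℂ) * G' (v, p.2)) := by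
    refine Measurable.stronglyMeasurable (Measurable.mul ?_ ?_)
    · have hc : Continuous fun y : V × V => ((𝐞 (-⟪y.1, y.2⟫_ℝ) : Circle) : ℂ) :=
        continuous_subtype_val.comp
          (Real.continuous_fourierChar.comp (continuous_fst.inner continuous_snd).neg)
      exact hc.measurable.comp (measurable_snd.prodMk (measurable_fst.comp measurable_fst))
    · exact hG'm.measurable.comp (measurable_snd.prodMk (measurable_snd.comp measurable_fst))
  have hΨ' : StronglyMeasurable fun p : V × X =>
      ∫ v, ((𝐞 (-⟪v, p.1⟫_ℝ) : Circle) : ℂ) * G' (v, p.2) :=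
    hker.integral_prod_right
  refine ⟨_, hΨ', ?_⟩
  have hswap : ∀ᵐ x ∂ν, ∀ᵐ v ∂(volume : Measure V), G (v, x) = G' (v, x) := by
    have h1 : (G ∘ Prod.swap) =ᵐ[ν.prod volume] (G' ∘ Prod.swap) :=
      (Measure.measurePreserving_swap (μ := ν) (ν := (volume : Measure V)))
        |>.quasiMeasurePreserving.ae_eq_comp hGG'
    exact Measure.ae_ae_of_ae_prod h1
  rw [Filter.EventuallyEq, ae_iff]
  refine measure_mono_null (t := (univ : Set V) ×ˢ
    {x | ¬ ∀ᵐ v ∂(volume : Measure V), G (v, x) = G' (v, x)}) ?_ ?_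
  · rintro ⟨q, x⟩ hqx
    refine ⟨mem_univ _, fun hx => hqx ?_⟩
    simp only [uncurry_apply_pair, Real.fourier_eq, Circle.smul_def, smul_eq_mul]
    exact integral_congr_ae (by filter_upwards [hx] with v hv; rw [hv])
  · rw [Measure.prod_prod, ae_iff.1 hswap, mul_zero]

/-! ### The engine -/

/-- **The `L²` engine of velocity averaging** (CIP 1994, proof of Lemma 5.3.8, p. 153,
abstract form). Let `U ∈ L¹(V × X)` vanish for `x ∉ S`, `G ∈ L¹ ∩ L²(V × X)`, and suppose that
for every `q` and `ν`-a.e. `x` the slice transforms satisfy `𝓕(G(·,x))(q) = m(q,x) 𝓕(U(·,x))(q)`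
with `m(q,·)` measurable and nowhere zero, and that the weight `w` obeys
`w(q) ∫_S |m(q,x)|⁻² dν ≤ C` for all `q`. Then the velocity average `ρ = ∫ U(·,x) dν` satisfies
`∫ w(q) |𝓕ρ(q)|² dq ≤ C ‖G‖²_{L²(V × X)}`. [cite: CIP1994, §5.3 Lemma 5.3.8 (proof)] -/
theorem lintegral_mul_enorm_fourier_integral_sq_le
    {U G : V × X → ℂ} {m : V → X → ℂ} {w : V → ℝ≥0∞} {S : Set X} {C : ℝ≥0∞}
    (hU1 : Integrable U (volume.prod ν)) (hG1 : Integrable G (volume.prod ν))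
    (hG2 : MemLp G 2 (volume.prod ν))
    (hS : MeasurableSet S) (hUS : ∀ v x, x ∉ S → U (v, x) = 0)
    (hm : ∀ q, Measurable (m q)) (hm0 : ∀ q x, m q x ≠ 0)
    (hident : ∀ q, ∀ᵐ x ∂ν, 𝓕 (fun v => G (v, x)) q = m q x * 𝓕 (fun v => U (v, x)) q)
    (hC : ∀ q, w q * ∫⁻ x in S, ‖(m q x)⁻¹‖ₑ ^ 2 ∂ν ≤ C) :
    ∫⁻ q, w q * ‖𝓕 (fun v => ∫ x, U (v, x) ∂ν) q‖ₑ ^ 2 ≤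
      C * ∫⁻ z, ‖G z‖ₑ ^ 2 ∂(volume.prod ν) := by
  -- slices of `G`
  have hGx1 : ∀ᵐ x ∂ν, Integrable (fun v => G (v, x)) volume := hG1.prod_left_ae
  have hGx2 : ∀ᵐ x ∂ν, MemLp (fun v => G (v, x)) 2 volume := by
    have h2 : Integrable (fun z => ‖G z‖ ^ 2) (volume.prod ν) :=
      (memLp_two_iff_integrable_sq_norm hG2.1).1 hG2
    filter_upwards [hGx1, h2.prod_left_ae] with x hx1 hx2
    exact (memLp_two_iff_integrable_sq_norm hx1.1).2 hx2
  -- the slice transforms of `G`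
  set Ψ : V → X → ℂ := fun q x => 𝓕 (fun v => G (v, x)) q with hΨ
  have hΨint : ∀ q, Integrable (Ψ q) ν := fun q => by
    have h : Integrable (fun x => ∫ v, ((𝐞 (-⟪v, q⟫_ℝ) : Circle) : ℂ) * G (v, x)) ν :=
      (integrable_fourierChar_mul q hG1).integral_prod_right
    simp only [hΨ, Real.fourier_eq, Circle.smul_def, smul_eq_mul]
    exact h
  have hΨm : AEMeasurable (uncurry fun q x => ‖Ψ q x‖ₑ ^ 2) (volume.prod ν) :=
    (aestronglyMeasurable_fourier_slice hG2.1).enorm.pow_const 2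
  -- pointwise bound on `|𝓕ρ(q)|²`
  have hbound : ∀ q, ‖𝓕 (fun v => ∫ x, U (v, x) ∂ν) q‖ₑ ^ 2 ≤
      (∫⁻ x in S, ‖(m q x)⁻¹‖ₑ ^ 2 ∂ν) * ∫⁻ x, ‖Ψ q x‖ₑ ^ 2 ∂ν := by
    intro q
    have hUx : ∀ᵐ x ∂ν,
        𝓕 (fun v => U (v, x)) q = S.indicator (fun x => (m q x)⁻¹) x * Ψ q x := by
      filter_upwards [hident q] with x hx
      by_cases hxS : x ∈ S
      · rw [indicator_of_mem hxS, hΨ]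
        simp only
        rw [hx, ← mul_assoc, inv_mul_cancel₀ (hm0 q x), one_mul]
      · rw [indicator_of_notMem hxS, zero_mul]
        have h0 : (fun v => U (v, x)) = fun _ => 0 := funext fun v => hUS v x hxS
        rw [h0]
        simp [Real.fourier_eq]
    have hf : AEMeasurable (fun x => S.indicator (fun x => ‖(m q x)⁻¹‖ₑ) x) ν :=
      (((hm q).inv).enorm.indicator hS).aemeasurable
    have hg : AEMeasurable (fun x => ‖Ψ q x‖ₑ) ν := (hΨint q).1.enorm
    calc ‖𝓕 (fun v => ∫ x, U (v, x) ∂ν) q‖ₑ ^ 2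
        = ‖∫ x, 𝓕 (fun v => U (v, x)) q ∂ν‖ₑ ^ 2 := by rw [fourier_integral_slice_eq hU1]
      _ ≤ (∫⁻ x, ‖𝓕 (fun v => U (v, x)) q‖ₑ ∂ν) ^ 2 := by
          gcongr
          exact enorm_integral_le_lintegral_enorm _
      _ = (∫⁻ x, ((fun x => S.indicator (fun x => ‖(m q x)⁻¹‖ₑ) x) * fun x => ‖Ψ q x‖ₑ) x
            ∂ν) ^ 2 := by
          congr 1
          refine lintegral_congr_ae ?_
          filter_upwards [hUx] with x hx
          rw [hx, enorm_mul, Pi.mul_apply]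
          congr 1
          by_cases hxS : x ∈ S <;> simp [hxS]
      _ ≤ ((∫⁻ x, S.indicator (fun x => ‖(m q x)⁻¹‖ₑ) x ^ (2 : ℝ) ∂ν) ^ (1 / (2 : ℝ)) *
            (∫⁻ x, ‖Ψ q x‖ₑ ^ (2 : ℝ) ∂ν) ^ (1 / (2 : ℝ))) ^ 2 := by
          gcongr
          exact ENNReal.lintegral_mul_le_Lp_mul_Lq ν Real.HolderConjugate.two_two hf hg
      _ = (∫⁻ x in S, ‖(m q x)⁻¹‖ₑ ^ 2 ∂ν) * ∫⁻ x, ‖Ψ q x‖ₑ ^ 2 ∂ν := by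
          rw [mul_rpow_half_sq, ← lintegral_indicator hS]
          simp only [ENNReal.rpow_ofNat]
          congr 1
          refine lintegral_congr fun x => ?_
          by_cases hxS : x ∈ S <;> simp [hxS]
  -- Plancherel on the slices
  have hPl : ∀ᵐ x ∂ν, ∫⁻ q, ‖Ψ q x‖ₑ ^ 2 = ∫⁻ v, ‖G (v, x)‖ₑ ^ 2 := by
    filter_upwards [hGx1, hGx2] with x hx1 hx2
    have h := Literature.Analysis.FluidPDE.FourierNS.eLpNorm_fourierIntegral_eq hx1 hx2
    rw [lintegral_enorm_sq_eq, lintegral_enorm_sq_eq (fun v => G (v, x))]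
    exact congrArg (· ^ 2) h
  -- assembling
  calc ∫⁻ q, w q * ‖𝓕 (fun v => ∫ x, U (v, x) ∂ν) q‖ₑ ^ 2
      ≤ ∫⁻ q, w q * ((∫⁻ x in S, ‖(m q x)⁻¹‖ₑ ^ 2 ∂ν) * ∫⁻ x, ‖Ψ q x‖ₑ ^ 2 ∂ν) :=
        lintegral_mono fun q => by
          gcongr
          exact hbound q
    _ ≤ ∫⁻ q, C * ∫⁻ x, ‖Ψ q x‖ₑ ^ 2 ∂ν :=
        lintegral_mono fun q => by
          rw [← mul_assoc]
          gcongr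
          exact hC q
    _ = C * ∫⁻ q, ∫⁻ x, ‖Ψ q x‖ₑ ^ 2 ∂ν := lintegral_const_mul'' C hΨm.lintegral_prod_right'
    _ = C * ∫⁻ x, ∫⁻ q, ‖Ψ q x‖ₑ ^ 2 ∂volume ∂ν := by rw [lintegral_lintegral_swap hΨm]
    _ = C * ∫⁻ x, ∫⁻ v, ‖G (v, x)‖ₑ ^ 2 ∂volume ∂ν := by rw [lintegral_congr_ae hPl]
    _ = C * ∫⁻ z, ‖G z‖ₑ ^ 2 ∂(volume.prod ν) := by
        rw [lintegral_prod_symm _ (hG2.1.enorm.pow_const 2)]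

/-! ### From the Fourier integral to the tree's Sobolev norm -/

/-- For `ρ ∈ L¹ ∩ L²(V)` the Fourier-side Sobolev norm of (the `L²` class of) `ρ` is computed
by the Fourier integral: `‖ρ‖_{H^s} = (∫ (1+‖q‖²)^s |𝓕ρ(q)|² dq)^{1/2}`
(`Literature.Analysis.FluidPDE.FourierNS.fourier_toLp_ae_eq`). [folklore] -/
theorem eFourierSobolevNorm_toLp_eq (s : ℝ) {ρ : V → ℂ} (hρ1 : Integrable ρ)
    (hρ2 : MemLp ρ 2 volume) :
    Literature.Analysis.FunctionSpaces.eFourierSobolevNorm s (hρ2.toLp ρ) =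
      (∫⁻ q, ENNReal.ofReal ((1 + ‖q‖ ^ 2) ^ s) * ‖𝓕 ρ q‖ₑ ^ 2) ^ (1 / 2 : ℝ) := by
  rw [Literature.Analysis.FunctionSpaces.eFourierSobolevNorm]
  congr 1
  refine lintegral_congr_ae ?_
  filter_upwards [Literature.Analysis.FluidPDE.FourierNS.fourier_toLp_ae_eq hρ1 hρ2] with q hq
  rw [hq]

end Engine

end Literature.MathematicalPhysics.KineticTheory
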